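import Summits.BirchSwinnertonDyer.BirchSwinnertonDyer.Theorems.ManinLocalTwoThreeKummerDiamondStepTwoTwoAdic
import HarnessLib

/-!
# es's STEP 2 (D6 of LEAD's `kummer_diamond` line), III: the Kummer classes `f_Q` of THEOREM K as functions of `σ` — uniqueness, additivity over
# coprime unitary divisors, «the complement of a prime power is never the whole character», «locating an active prime»
(route `ManinLocalTwoThree`, crux C2 `ManinOddAtFour` stmt-BirchSwinnertonDyer-22967; cell bsd-f2-manin, prover p2 gen 21; nodes for the Lean proof of E-es-185
`IndexFourForcesFreyTwistShape`, es g38 PROOF-Ees185-186.md §4 PROPOSITION A STEP 1–2 («independence», «spanning», «`#S′ = 2`»);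
`--supports stmt-BirchSwinnertonDyer-22967`)

ABSTRACT CURRENCY (parts I–II): `w : Γ₀(N) → V` (diamond values), a Galois-type set `G` with a relation `cyc σ d` («`σ(ζ_N) = ζ_N^d`»), and for a coprime
splitting `N = Q·y` the THEOREM-K SHAPE of a function `f : G → V`: `f σ = w γ` whenever `dd′ ≡ 1 (N)`, `cyc σ d`, `d_γ ≡ d′ (Q)`, `d_γ ≡ 1 (y)` — exactly the
conclusion of es g39's `indexFour_kummerDiamondReciprocity` for `σ ↦ σ(S_y) − S_y`.
* §8 `exists_gamma0_of_inv` (es's `e_d`), `kum_apply` / `kum_surj` (values of `f_Q` = the `Q`-component diamond values), `kum_unique`, `kum_add` (`N = ABC`: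
  `f_{(A,BC)} + f_{(B,AC)} = f_{(AB,C)}`), `kum_complement_ne_zero` (for `p^b ∥ N` the class of the complement is non-zero once `|im ϖ| ≥ 4`: cyclic / lone-`2`
  bounds), `exists_active_prime` (a non-zero class on a unitary divisor `u` comes from a non-zero prime-power class `f_{p^b}`, `p ∣ u` — strong induction).
* §9 helpers: `exists_gamma0_odd_rep`, `zmod_eight_eq_of_mul_eq_one`, `pairwise_ne_of_ncard_four`.
UNCONDITIONAL; nothing about E-es-185, C2, Manin's conjecture or BSD is proved.  No definitions, no sorry. [folklore] [cite: Stevens1989, §2]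
-/

set_option autoImplicit false
-- lint-debt: the directory name repeats the summit name (sibling precedent `ManinLocalTwoThreeKummerDiamondStepTwoTwoAdic.lean`)
set_option linter.dupNamespace false

open scoped MatrixGroups
open CongruenceSubgroup

namespace Summit.BirchSwinnertonDyer.BirchSwinnertonDyer.Theorems.ManinLocalTwoThree.StepTwo

variable {N : ℕ}

/-! ## §8 Kummer-class bookkeeping: the `Q`-components `f_Q` of THEOREM K as functions of `σ` -/

section Kummer

/-- For `dd′ ≡ 1 (mod N)` and a coprime splitting `N = Q·y` there is `γ ∈ Γ₀(N)` with `d_γ ≡ d′ (mod Q)`, `d_γ ≡ 1 (mod y)` (es's `e_d`). [folklore] -/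
theorem exists_gamma0_of_inv {Q y : ℕ} (hQy : Q * y = N) (hcop : Nat.Coprime Q y) {d d' : ℤ}
    (hdd' : ((d * d' : ℤ) : ZMod N) = 1) :
    ∃ γ : Gamma0 N, ((((γ : SL(2, ℤ)) 1 1 : ℤ)) : ZMod Q) = (d' : ZMod Q) ∧ ((((γ : SL(2, ℤ)) 1 1 : ℤ)) : ZMod y) = 1 := by
  obtain ⟨e, heQ, hey⟩ := exists_int_cast_eq_cast_eq hcop d' 1
  have hey' : (e : ZMod y) = 1 := by rw [hey]; push_cast; rfl
  have hQN : Q ∣ N := ⟨y, hQy.symm⟩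
  have hcopr : IsCoprime e (N : ℤ) := by
    refine isCoprime_of_cast_mul_eq_one hQy hcop (d := d) ?_ hey'
    have h := congrArg (ZMod.castHom hQN (ZMod Q)) hdd'
    rw [map_intCast, map_one] at h
    push_cast at h heQ ⊢
    rw [heQ, mul_comm]; exact h
  obtain ⟨γ, hγ⟩ := SmallImageLemmaPrimeReduction.exists_gamma0_apply_one_one_eq hcopr
  exact ⟨γ, by rw [hγ, heQ], by rw [hγ, hey']⟩

/-- **Values of `f_Q` are `Q`-component diamond values**: if `f` satisfies THEOREM K for the splitting `(Q, y)` then every `f σ` is `w γ` for some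
`d_γ ≡ 1 (mod y)`. [folklore] -/
theorem kum_apply {V G : Type*} (w : Gamma0 N → V) (cyc : G → ℤ → Prop) {Q y : ℕ} (hQy : Q * y = N) (hcop : Nat.Coprime Q y)
    (hcyc : ∀ σ : G, ∃ d d' : ℤ, ((d * d' : ℤ) : ZMod N) = 1 ∧ cyc σ d) {f : G → V}
    (hf : ∀ (σ : G) (d d' : ℤ), ((d * d' : ℤ) : ZMod N) = 1 → cyc σ d → ∀ γ : Gamma0 N,
      ((((γ : SL(2, ℤ)) 1 1 : ℤ)) : ZMod Q) = (d' : ZMod Q) → ((((γ : SL(2, ℤ)) 1 1 : ℤ)) : ZMod y) = 1 → f σ = w γ)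
    (σ : G) : ∃ γ : Gamma0 N, ((((γ : SL(2, ℤ)) 1 1 : ℤ)) : ZMod y) = 1 ∧ f σ = w γ := by
  obtain ⟨d, d', hdd', hσ⟩ := hcyc σ
  obtain ⟨γ, hγQ, hγy⟩ := exists_gamma0_of_inv hQy hcop hdd'
  exact ⟨γ, hγy, hf σ d d' hdd' hσ γ hγQ hγy⟩

/-- **Conversely every `Q`-component diamond value is a value of `f_Q`** (Galois supply: some `σ` acts on `ζ_N` by `d_γ⁻¹`). [folklore] -/
theorem kum_surj {V G : Type*} (w : Gamma0 N → V) (cyc : G → ℤ → Prop)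
    {Q y : ℕ} (hsup : ∀ d : ℤ, IsCoprime d (N : ℤ) → ∃ σ : G, cyc σ d)
    {f : G → V}
    (hf : ∀ (σ : G) (d d' : ℤ), ((d * d' : ℤ) : ZMod N) = 1 → cyc σ d → ∀ γ : Gamma0 N,
      ((((γ : SL(2, ℤ)) 1 1 : ℤ)) : ZMod Q) = (d' : ZMod Q) → ((((γ : SL(2, ℤ)) 1 1 : ℤ)) : ZMod y) = 1 → f σ = w γ)
    (γ : Gamma0 N) (hγ : ((((γ : SL(2, ℤ)) 1 1 : ℤ)) : ZMod y) = 1) : ∃ σ : G, f σ = w γ := by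
  obtain ⟨u, v, huv⟩ := isCoprime_lowerRight γ
  have hu : IsCoprime u (N : ℤ) := ⟨((γ : SL(2, ℤ)) 1 1 : ℤ), v, by linear_combination huv⟩
  obtain ⟨σ, hσ⟩ := hsup u hu
  refine ⟨σ, hf σ u ((γ : SL(2, ℤ)) 1 1 : ℤ) ?_ hσ γ rfl hγ⟩
  have e : u * ((γ : SL(2, ℤ)) 1 1 : ℤ) = 1 + (-v) * N := by linear_combination huv
  rw [e]; push_cast; simp

/-- Casting a congruence down a divisor. [folklore] -/
theorem cast_down {m n : ℕ} (hmn : m ∣ n) {s t : ℤ} (h : (s : ZMod n) = (t : ZMod n)) : (s : ZMod m) = (t : ZMod m) := by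
  have h' := congrArg (ZMod.castHom hmn (ZMod m)) h
  rwa [map_intCast, map_intCast] at h'

/-- Casting `≡ 1` down a divisor. [folklore] -/
theorem cast_down_one {m n : ℕ} (hmn : m ∣ n) {s : ℤ} (h : (s : ZMod n) = 1) : (s : ZMod m) = 1 := by
  have h' := congrArg (ZMod.castHom hmn (ZMod m)) h
  rwa [map_intCast, map_one] at h'

/-- **Uniqueness**: two functions satisfying THEOREM K for the same splitting agree. [folklore] -/
theorem kum_unique {V G : Type*} (w : Gamma0 N → V) (cyc : G → ℤ → Prop) {Q y : ℕ} (hQy : Q * y = N)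
    (hcop : Nat.Coprime Q y) (hcyc : ∀ σ : G, ∃ d d' : ℤ, ((d * d' : ℤ) : ZMod N) = 1 ∧ cyc σ d) {f f' : G → V}
    (hf : ∀ (σ : G) (d d' : ℤ), ((d * d' : ℤ) : ZMod N) = 1 → cyc σ d → ∀ γ : Gamma0 N,
      ((((γ : SL(2, ℤ)) 1 1 : ℤ)) : ZMod Q) = (d' : ZMod Q) → ((((γ : SL(2, ℤ)) 1 1 : ℤ)) : ZMod y) = 1 → f σ = w γ)
    (hf' : ∀ (σ : G) (d d' : ℤ), ((d * d' : ℤ) : ZMod N) = 1 → cyc σ d → ∀ γ : Gamma0 N,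
      ((((γ : SL(2, ℤ)) 1 1 : ℤ)) : ZMod Q) = (d' : ZMod Q) → ((((γ : SL(2, ℤ)) 1 1 : ℤ)) : ZMod y) = 1 → f' σ = w γ) :
    f = f' := by
  funext σ
  obtain ⟨d, d', hdd', hσ⟩ := hcyc σ
  obtain ⟨γ, hγQ, hγy⟩ := exists_gamma0_of_inv hQy hcop hdd'
  rw [hf σ d d' hdd' hσ γ hγQ hγy, hf' σ d d' hdd' hσ γ hγQ hγy]

/-- **Additivity over coprime unitary divisors**: `N = A·B·C` pairwise coprime; if `f` satisfies THEOREM K for `(A, BC)` and `g` for `(B, AC)` then `f + g`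
satisfies it for `(AB, C)` (`w` additive and through `d_γ mod N`). [folklore] -/
theorem kum_add {V G : Type*} [AddCommGroup V] (w : Gamma0 N → V) (cyc : G → ℤ → Prop)
    (hmul : ∀ γ γ' : Gamma0 N, w (γ * γ') = w γ + w γ')
    (hone : ∀ γ : Gamma0 N, ((((γ : SL(2, ℤ)) 1 1 : ℤ)) : ZMod N) = 1 → w γ = 0)
    {A B C : ℕ} (hN : A * B * C = N) (hAB : Nat.Coprime A B) (hAC : Nat.Coprime A C) (hBC : Nat.Coprime B C) {f g : G → V}
    (hf : ∀ (σ : G) (d d' : ℤ), ((d * d' : ℤ) : ZMod N) = 1 → cyc σ d → ∀ γ : Gamma0 N,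
      ((((γ : SL(2, ℤ)) 1 1 : ℤ)) : ZMod A) = (d' : ZMod A) → ((((γ : SL(2, ℤ)) 1 1 : ℤ)) : ZMod (B * C)) = 1 → f σ = w γ)
    (hg : ∀ (σ : G) (d d' : ℤ), ((d * d' : ℤ) : ZMod N) = 1 → cyc σ d → ∀ γ : Gamma0 N,
      ((((γ : SL(2, ℤ)) 1 1 : ℤ)) : ZMod B) = (d' : ZMod B) → ((((γ : SL(2, ℤ)) 1 1 : ℤ)) : ZMod (A * C)) = 1 → g σ = w γ) :
    ∀ (σ : G) (d d' : ℤ), ((d * d' : ℤ) : ZMod N) = 1 → cyc σ d → ∀ γ : Gamma0 N,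
      ((((γ : SL(2, ℤ)) 1 1 : ℤ)) : ZMod (A * B)) = (d' : ZMod (A * B)) → ((((γ : SL(2, ℤ)) 1 1 : ℤ)) : ZMod C) = 1 →
        (f + g) σ = w γ := by
  subst hN
  intro σ d d' hdd' hσ γ hγAB hγC
  have hABC : Nat.Coprime (A * B) C := Nat.Coprime.mul_left hAC hBC
  obtain ⟨γ₁, h₁A, h₁BC⟩ := exists_gamma0_of_inv (Q := A) (y := B * C) (by ring) (Nat.Coprime.mul_right hAB hAC) hdd'
  obtain ⟨γ₂, h₂B, h₂AC⟩ := exists_gamma0_of_inv (Q := B) (y := A * C) (by ring) (Nat.Coprime.mul_right hAB.symm hBC) hdd'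
  rw [Pi.add_apply, hf σ d d' hdd' hσ γ₁ h₁A h₁BC, hg σ d d' hdd' hσ γ₂ h₂B h₂AC, ← hmul]
  apply w_eq_of_cast_eq w hmul dvd_rfl hone
  have hA : A ∣ A * B * C := ⟨B * C, by ring⟩
  have hB : B ∣ A * B * C := ⟨A * C, by ring⟩
  have hC : C ∣ A * B * C := ⟨A * B, by ring⟩
  rw [intCast_zmod_mul_eq_iff_of_coprime hABC, intCast_zmod_mul_eq_iff_of_coprime hAB,
    lowerRight_mul_cast _ _ hA, lowerRight_mul_cast _ _ hB, lowerRight_mul_cast _ _ hC]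
  refine ⟨⟨?_, ?_⟩, ?_⟩
  · rw [h₁A, cast_down_one (dvd_mul_right A C) h₂AC, mul_one, cast_down (dvd_mul_right A B) hγAB]
  · rw [h₂B, cast_down_one (dvd_mul_right B C) h₁BC, one_mul, cast_down (dvd_mul_left B A) hγAB]
  · rw [cast_down_one (dvd_mul_left C B) h₁BC, cast_down_one (dvd_mul_left C A) h₂AC, one_mul, hγC]

/-- At most two values: `(range w).ncard ≤ 2`. [folklore] -/
theorem ncard_range_le_two {V : Type*} [AddCommGroup V] {w : Gamma0 N → V} {v : V} (h : ∀ γ, w γ = 0 ∨ w γ = v) :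
    (Set.range w).ncard ≤ 2 := by
  have hsub : Set.range w ⊆ ({0, v} : Set V) := by
    rintro _ ⟨γ, rfl⟩
    rcases h γ with h | h <;> simp [h]
  exact (Set.ncard_le_ncard hsub (Set.toFinite _)).trans ((Set.ncard_insert_le _ _).trans (by rw [Set.ncard_singleton]))

/-- **The complement of a prime power never carries the whole character**: for `N = p^b·y` the function `g` of THEOREM K for the splitting `(y, p^b)`
(the part of the diamond character away from `p`) is not identically zero once `im ϖ` has `≥ 4` elements — else `ϖ = ϖ_{p^b}` would have `≤ 2` values
(`p` odd: cyclic; `p = 2`: the lone-`2` exclusion, using `ϖ(−1) = 0`). [folklore] -/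
theorem kum_complement_ne_zero [NeZero N] {V G : Type*} [AddCommGroup V] (w : Gamma0 N → V) (cyc : G → ℤ → Prop)
    (hmul : ∀ γ γ' : Gamma0 N, w (γ * γ') = w γ + w γ')
    (hone : ∀ γ : Gamma0 N, ((((γ : SL(2, ℤ)) 1 1 : ℤ)) : ZMod N) = 1 → w γ = 0) (h2 : ∀ γ : Gamma0 N, w γ + w γ = 0)
    (hneg : ∀ γ : Gamma0 N, ((((γ : SL(2, ℤ)) 1 1 : ℤ)) : ZMod N) = -1 → w γ = 0) (hK : 4 ≤ (Set.range w).ncard)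
    (hsup : ∀ d : ℤ, IsCoprime d (N : ℤ) → ∃ σ : G, cyc σ d)
    {p b y : ℕ} (hp : p.Prime) (hQy : p ^ b * y = N) (hcop : Nat.Coprime (p ^ b) y) {g : G → V}
    (hg : ∀ (σ : G) (d d' : ℤ), ((d * d' : ℤ) : ZMod N) = 1 → cyc σ d → ∀ γ : Gamma0 N,
      ((((γ : SL(2, ℤ)) 1 1 : ℤ)) : ZMod y) = (d' : ZMod y) → ((((γ : SL(2, ℤ)) 1 1 : ℤ)) : ZMod (p ^ b)) = 1 → g σ = w γ) :
    g ≠ 0 := by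
  intro hg0
  have hkill : ∀ γ : Gamma0 N, ((((γ : SL(2, ℤ)) 1 1 : ℤ)) : ZMod (p ^ b)) = 1 → w γ = 0 := by
    intro γ hγ
    obtain ⟨σ, hσ⟩ := kum_surj w cyc hsup hg γ hγ
    rw [← hσ, hg0, Pi.zero_apply]
  have hQN : p ^ b ∣ N := ⟨y, hQy.symm⟩
  suffices hv : ∃ v : V, ∀ γ : Gamma0 N, w γ = 0 ∨ w γ = v by
    obtain ⟨v, hv⟩ := hv
    have := ncard_range_le_two hv
    omega
  by_cases hp2 : p = 2
  · subst hp2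
    exact exists_forall_eq_zero_or_eq_of_lone_two w hmul h2 hQy hcop hkill hneg
  · obtain ⟨v, hv⟩ := exists_forall_eq_zero_or_eq_primePow w hmul hone h2 hp hp2 hQy hcop
    refine ⟨v, fun γ ↦ ?_⟩
    -- move `γ` to `d ≡ d_γ (p^b)`, `≡ 1 (y)` without changing `w`
    obtain ⟨u, t, hut⟩ := isCoprime_lowerRight γ
    have hdd' : ((u * ((γ : SL(2, ℤ)) 1 1 : ℤ) : ℤ) : ZMod N) = 1 := by
      have e : u * ((γ : SL(2, ℤ)) 1 1 : ℤ) = 1 + (-t) * N := by linear_combination hut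
      rw [e]; push_cast; simp
    obtain ⟨γ', hγ'Q, hγ'y⟩ := exists_gamma0_of_inv hQy hcop hdd'
    rw [w_eq_of_cast_eq w hmul hQN hkill hγ'Q.symm]
    exact hv γ' hγ'y

/-- **Locating an active prime** (es: independence of the non-zero `h_Q`, in additive form): if the function of THEOREM K for a unitary divisor `u` of `N`
is non-zero, some prime power `p^b ∥ N` with `p ∣ u` has a non-zero function. [folklore] -/
theorem exists_active_prime [NeZero N] {V G : Type*} [AddCommGroup V] (w : Gamma0 N → V) (cyc : G → ℤ → Prop)
    (hmul : ∀ γ γ' : Gamma0 N, w (γ * γ') = w γ + w γ')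
    (hone : ∀ γ : Gamma0 N, ((((γ : SL(2, ℤ)) 1 1 : ℤ)) : ZMod N) = 1 → w γ = 0)
    (hcyc : ∀ σ : G, ∃ d d' : ℤ, ((d * d' : ℤ) : ZMod N) = 1 ∧ cyc σ d) (𝒱 : AddSubgroup (G → V))
    (hKum : ∀ Q y : ℕ, Q * y = N → Nat.Coprime Q y → ∃ f ∈ 𝒱, ∀ (σ : G) (d d' : ℤ), ((d * d' : ℤ) : ZMod N) = 1 → cyc σ d →
      ∀ γ : Gamma0 N, ((((γ : SL(2, ℤ)) 1 1 : ℤ)) : ZMod Q) = (d' : ZMod Q) → ((((γ : SL(2, ℤ)) 1 1 : ℤ)) : ZMod y) = 1 → f σ = w γ)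
    (u : ℕ) (hu : u ∣ N) (hcu : Nat.Coprime u (N / u)) (f : G → V)
    (hf : ∀ (σ : G) (d d' : ℤ), ((d * d' : ℤ) : ZMod N) = 1 → cyc σ d → ∀ γ : Gamma0 N,
      ((((γ : SL(2, ℤ)) 1 1 : ℤ)) : ZMod u) = (d' : ZMod u) → ((((γ : SL(2, ℤ)) 1 1 : ℤ)) : ZMod (N / u)) = 1 → f σ = w γ)
    (hf0 : f ≠ 0) :
    ∃ (p b y : ℕ) (fp : G → V), p.Prime ∧ 1 ≤ b ∧ p ^ b * y = N ∧ Nat.Coprime (p ^ b) y ∧ p ∣ u ∧ fp ∈ 𝒱 ∧ fp ≠ 0 ∧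
      ∀ (σ : G) (d d' : ℤ), ((d * d' : ℤ) : ZMod N) = 1 → cyc σ d → ∀ γ : Gamma0 N,
        ((((γ : SL(2, ℤ)) 1 1 : ℤ)) : ZMod (p ^ b)) = (d' : ZMod (p ^ b)) → ((((γ : SL(2, ℤ)) 1 1 : ℤ)) : ZMod y) = 1 → fp σ = w γ := by
  induction u using Nat.strong_induction_on generalizing f with
  | _ u ih =>
  have hN0 : N ≠ 0 := NeZero.ne N
  have hu0 : u ≠ 0 := fun h ↦ hN0 (Nat.eq_zero_of_zero_dvd (h ▸ hu))
  have huC : u * (N / u) = N := Nat.mul_div_cancel' hu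
  -- `u ≠ 1`
  have hu1 : u ≠ 1 := by
    rintro rfl
    apply hf0
    funext σ
    obtain ⟨γ, hγy, hσ⟩ := kum_apply w cyc huC hcu hcyc hf σ
    rw [hσ, Pi.zero_apply]
    exact hone γ (by rwa [Nat.div_one] at hγy)
  obtain ⟨p, hp, hpu⟩ := Nat.exists_prime_and_dvd hu1
  set Q : ℕ := p ^ u.factorization p with hQ
  set u' : ℕ := u / p ^ u.factorization p with hu'
  have hQu' : Q * u' = u := Nat.ordProj_mul_ordCompl_eq_self u p
  have hb : 1 ≤ u.factorization p := hp.factorization_pos_of_dvd hu0 hpu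
  have hQu'cop : Nat.Coprime Q u' := (Nat.coprime_ordCompl hp hu0).pow_left _
  have hQC : Nat.Coprime Q (N / u) := Nat.Coprime.coprime_dvd_left (Nat.ordProj_dvd u p) hcu
  have hu'C : Nat.Coprime u' (N / u) := Nat.Coprime.coprime_dvd_left (Nat.ordCompl_dvd u p) hcu
  have hN3 : Q * u' * (N / u) = N := by rw [hQu', huC]
  obtain ⟨fQ, hfQ𝒱, hfQ⟩ := hKum Q (u' * (N / u)) (by rw [← mul_assoc, hN3]) (Nat.Coprime.mul_right hQu'cop hQC)
  obtain ⟨fu, hfu𝒱, hfu⟩ := hKum u' (Q * (N / u)) (by rw [mul_left_comm, ← mul_assoc, hN3])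
    (Nat.Coprime.mul_right hQu'cop.symm hu'C)
  have hadd := kum_add w cyc hmul hone hN3 hQu'cop hQC hu'C hfQ hfu
  rw [hQu'] at hadd
  have hsum : fQ + fu = f := kum_unique w cyc huC hcu hcyc hadd hf
  by_cases hfQ0 : fQ ≠ 0
  · exact ⟨p, u.factorization p, u' * (N / u), fQ, hp, hb, by rw [← mul_assoc, hN3], Nat.Coprime.mul_right hQu'cop hQC, hpu,
      hfQ𝒱, hfQ0, hfQ⟩
  · rw [not_ne_iff] at hfQ0
    have hfu0 : fu ≠ 0 := by
      intro h; apply hf0; rw [← hsum, hfQ0, h, add_zero]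
    have hQ1 : 1 < Q := by rw [hQ]; exact Nat.one_lt_pow (by omega) hp.one_lt
    have hu'0 : u' ≠ 0 := fun h ↦ hu0 (by rw [← hQu', h, mul_zero])
    have hlt : u' < u := by rw [← hQu']; nlinarith [Nat.pos_of_ne_zero hu'0]
    have hu'N : u' ∣ N := dvd_trans (Nat.ordCompl_dvd u p) hu
    have hNu' : N / u' = Q * (N / u) := by
      refine Nat.div_eq_of_eq_mul_left (Nat.pos_of_ne_zero hu'0) ?_
      rw [mul_right_comm]; exact hN3.symm
    have hcu' : Nat.Coprime u' (N / u') := by rw [hNu']; exact Nat.Coprime.mul_right hQu'cop.symm hu'C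
    rw [← hNu'] at hfu
    obtain ⟨p', b', y', fp, hp', hb', hN', hcop', hp'u', hfp𝒱, hfp0, hfp⟩ := ih u' hlt hu'N hcu' fu hfu hfu0
    exact ⟨p', b', y', fp, hp', hb', hN', hcop', dvd_trans hp'u' (Nat.ordCompl_dvd u p), hfp𝒱, hfp0, hfp⟩

end Kummer

/-! ## §9 Small helpers for PROPOSITION A -/

section Helpers

/-- Odd representatives: for `N = 2^a·y`, `gcd(2^a, y) = 1`, `r` odd there is `γ ∈ Γ₀(N)` with `d_γ ≡ r (mod 2^a)`, `d_γ ≡ 1 (mod y)`. [folklore] -/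
theorem exists_gamma0_odd_rep {a y : ℕ} (hQy : 2 ^ a * y = N) (hcop : Nat.Coprime (2 ^ a) y) {r : ℤ} (hr : Odd r) :
    ∃ γ : Gamma0 N, ((((γ : SL(2, ℤ)) 1 1 : ℤ)) : ZMod (2 ^ a)) = (r : ZMod (2 ^ a)) ∧ ((((γ : SL(2, ℤ)) 1 1 : ℤ)) : ZMod y) = 1 := by
  obtain ⟨e, he2, hey⟩ := exists_int_cast_eq_cast_eq hcop r 1
  have hey' : (e : ZMod y) = 1 := by rw [hey]; push_cast; rfl
  have hcop2 : IsCoprime e ((2 : ℤ) ^ a) := by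
    rcases Nat.eq_zero_or_pos a with rfl | ha
    · rw [pow_zero]; exact isCoprime_one_right
    · have hdiff : ((2 ^ a : ℕ) : ℤ) ∣ r - e := (ZMod.intCast_eq_intCast_iff_dvd_sub e r (2 ^ a)).mp he2
      have h2a : (2 : ℤ) ∣ ((2 ^ a : ℕ) : ℤ) := by push_cast; exact dvd_pow_self 2 (by omega)
      obtain ⟨t, ht⟩ := dvd_trans h2a hdiff
      obtain ⟨k, hk⟩ := hr
      exact IsCoprime.pow_right ⟨1, -(k - t), by linear_combination hk - ht⟩
  have hcopy : IsCoprime e (y : ℤ) := by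
    obtain ⟨t, ht⟩ := (ZMod.intCast_eq_intCast_iff_dvd_sub 1 e y).mp (by rw [hey']; push_cast; rfl)
    exact ⟨1, -t, by linear_combination ht⟩
  have hcopN : IsCoprime e (N : ℤ) := by
    rw [← hQy]; push_cast; exact IsCoprime.mul_right hcop2 hcopy
  obtain ⟨γ, hγ⟩ := SmallImageLemmaPrimeReduction.exists_gamma0_apply_one_one_eq hcopN
  exact ⟨γ, by rw [hγ, he2], by rw [hγ, hey']⟩

/-- Units of `ℤ/8` are their own inverses. [folklore] -/
theorem zmod_eight_eq_of_mul_eq_one : ∀ x y : ZMod 8, x * y = 1 → x = y := by decide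

/-- Four values with `4 ≤ ncard` are pairwise distinct. [folklore] -/
theorem pairwise_ne_of_ncard_four {V : Type*} {a b c d : V} (h : 4 ≤ ({a, b, c, d} : Set V).ncard) :
    a ≠ b ∧ a ≠ c ∧ a ≠ d ∧ b ≠ c ∧ b ≠ d ∧ c ≠ d := by
  have h3 : ∀ x y z : V, ({x, y, z} : Set V).ncard ≤ 3 := fun x y z ↦
    (Set.ncard_insert_le _ _).trans (by linarith [Set.ncard_insert_le y ({z} : Set V), Set.ncard_singleton z])
  refine ⟨?_, ?_, ?_, ?_, ?_, ?_⟩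
  · rintro rfl
    rw [Set.insert_eq_of_mem (by simp : a ∈ ({a, c, d} : Set V))] at h; linarith [h3 a c d]
  · rintro rfl
    rw [Set.insert_eq_of_mem (by simp : a ∈ ({b, a, d} : Set V))] at h; linarith [h3 b a d]
  · rintro rfl
    rw [Set.insert_eq_of_mem (by simp : a ∈ ({b, c, a} : Set V))] at h; linarith [h3 b c a]
  · rintro rfl
    rw [Set.insert_eq_of_mem (by simp : b ∈ ({b, d} : Set V))] at h; linarith [h3 a b d]
  · rintro rfl
    rw [Set.insert_eq_of_mem (by simp : b ∈ ({c, b} : Set V))] at h; linarith [h3 a c b]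
  · rintro rfl
    rw [Set.insert_eq_of_mem (by simp : c ∈ ({c} : Set V))] at h; linarith [h3 a b c]

end Helpers

end Summit.BirchSwinnertonDyer.BirchSwinnertonDyer.Theorems.ManinLocalTwoThree.StepTwo
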